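import Mathlib.RingTheory.RootsOfUnity.AlgebraicallyClosed
import Mathlib.FieldTheory.Galois.Infinite
import Literature.AnabelianGeometry.AbsoluteAnabelian.AbsTopIII.KummerFaithfulLocalFieldProofs
import HarnessLib

/-!
# [AbsTopIII] Prop 3.3 (ii), the `{±1}`-torsor half at the model: a Galois-equivariant
# multiplicative automorphism of `k̄^×` is the identity or the inversion

Proof-only companion (theorems only, no new definitions) in the lane of `MonoidKummerMaps.lean`
(seat abc-iut-L4-t2; typer of THIS file: abc-iut-L6-d1, p409829; S. Mochizuki, *Topics in Absolute
Anabelian Geometry III*, kurims manuscript, lit key `paper:url-5493eb38cbb7`).  Print, Prop. 3.3 (i),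
p. 73: "the natural isomorphism `μ_Ẑ(M) ⥲ μ_Ẑ(G)` [cf. Remark 3.2.1] is only determined up to a `{±1}`-
(respectively, `Ẑ^×`-)multiple if `T = TLG` (respectively, `T = TCG`)"; Prop. 3.3 (ii), p. 74: "If
`T = TLG`, then the homomorphism `Isom_{𝒞^MLF_T}((Π ↷ M),(Π* ↷ M*)) → Isom_{𝒯𝒢}(Π, Π*)` is surjective,
with fibers of cardinality two."  Paraphrase (ours, not print): the isomorphisms of MLF-Galois `TLG`-pairs
lying over a given isomorphism of Galois groups are determined up to the natural action of
`{±1} ⊆ Ẑ^×` on `k̄^×`.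

The typed named fact `UnitPairIsoFibres` (abc-iut-L4-t2) is the conjunction of a DETERMINATION
statement (PROVED by abc-iut-L6-t21, `MonoidKummerMapsUnitPairProofs.unitPairIso_isoM_eq`) and of a
statement "every fibre over an admissible `Π ⥲ Π*` has exactly two elements".  The latter splits
into EXISTENCE of a lift (the local-class-field-theoretic reconstruction of `k̄^×` from `G_k`,
[AbsAnab] Prop. 1.2.1 — NOT addressed in the tree) and the `{±1}`-TORSOR structure of each fibre,
whose mathematical content is the following classical statement, PROVED here at the model data
`(k, k̄)` of [AbsTopIII] §3 (`MLFClosure`):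

* `MLFClosure.nonZeroDivisors_equivariant_rootsOfUnity_sign` — a `Gal(k̄/k)`-equivariant
  multiplicative automorphism `β` of `k̄^× = (k̄)⁰` acts on ALL roots of unity either trivially or by
  inversion.  Proof: `β` acts on `μ_n` by an exponent `a_n` (`μ_n` is cyclic, generated by a
  primitive root); for an `n`-th root `y` of a UNIFORMIZER `π` of `k` the quotient `β(y)/y^{a_n}` is
  `Gal(k̄/k)`-invariant, hence in `k`, so `β(π) = Z^n · π^{a_n}` with `Z ∈ k^×` and
  `a_n ≡ ord_k(β(π)) =: A (mod n)` for EVERY `n` (`ord_k` from Mathlib's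
  `IsNonarchimedeanLocalField.valueGroupWithZeroIsoInt`); injectivity of `β` on a primitive
  `|A|`-th root of unity (resp. on `−1`) forces `A = ±1`.
* `MLFClosure.nonZeroDivisors_equivariant_eq_id_or_inv` — such a `β` is the identity or the
  inversion `x ↦ x⁻¹` (the previous statement + the Kummer-class rigidity engine
  `MLFClosure.submonoid_equivariant_eq_self` of abc-iut-L6-t21, applied to `β` resp. `β ∘ inv`).

No local class field theory and no cohomology is used.  HONEST FRAMING: OUR kernel check of a
classical statement quoted by a refereed paper; nothing here bears on [IUTchIII] Cor. 3.12.

THEOREM OF RECORD (revision note): `MLFClosure.nonZeroDivisors_equivariant_eq_id_or_inv` below is the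
SAME statement as abc-iut-L6-t21's EARLIER `MLFClosure.nonZeroDivisors_mulEquiv_eq_self_or_eq_inv`
(`Literature/AnabelianGeometry/AbsoluteAnabelian/MLFGaloisUnitsRigidityProofs.lean`, p409421), proved
independently (the two filings crossed); cite abc-iut-L6-t21's theorem as the theorem of record — this
file stands as an alternative proof (sign read off from one uniformizer and injectivity on a primitive
root, instead of the product trick) and for its small reusable lemmas (`MLFClosure.charZero_K`,
`MLFClosure.exists_isPrimitiveRoot`, `MLFClosure.exists_ord_uniformizer`, `MLFClosure.exists_toAdd_ord`).
-/

noncomputable section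

namespace Literature.AnabelianGeometry.AbsoluteAnabelian

open scoped nonZeroDivisors
open _root_.ValuativeRel

universe u

variable (C : MLFClosure.{u})

/-! ### Preliminaries on the model data `(k, k̄)` -/

/-- The algebraic closure `k̄` of the model data has characteristic zero.
[cite: MochizukiAbsTopIII2015, Definition 3.1 (i) p.66] -/
theorem MLFClosure.charZero_K : CharZero C.K :=
  charZero_of_injective_algebraMap (algebraMap C.k C.K).injective

/-- `k̄` contains a primitive `n`-th root of unity for every `n ≥ 1`.
[cite: MochizukiAbsTopIII2015, Definition 3.1 (i) p.66] -/
theorem MLFClosure.exists_isPrimitiveRoot (n : ℕ) (hn : 0 < n) : ∃ ζ : C.K, IsPrimitiveRoot ζ n := by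
  haveI : IsAlgClosed C.K := IsAlgClosure.isAlgClosed C.k
  haveI : CharZero C.K := C.charZero_K
  haveI : NeZero n := ⟨hn.ne'⟩
  exact HasEnoughRootsOfUnity.exists_primitiveRoot C.K n

/-- An integer-valued valuation on the MLF `k` together with a uniformizer: a multiplicative map
`ord : k^× → ℤ` and `π ∈ k^×` with `ord π = 1` (from Mathlib's `valueGroupWithZeroIsoInt`, the value
group of a non-archimedean local field being `ℤ`). [cite: MochizukiAbsTopIII2015, Definition 3.1 (i) p.66] -/
theorem MLFClosure.exists_ord_uniformizer :
    ∃ (ord : C.kˣ →* Multiplicative ℤ) (π : C.kˣ), ord π = Multiplicative.ofAdd 1 := by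
  let e := IsNonarchimedeanLocalField.valueGroupWithZeroIsoInt C.k
  -- the valuation composed with `e`, as a monoid hom `k → WithZero (Multiplicative ℤ)`
  let w : C.k →* WithZero (Multiplicative ℤ) := e.toMulEquiv.toMonoidHom.comp (valuation C.k).toMonoidWithZeroHom.toMonoidHom
  have hw : ∀ x : C.k, w x = e (valuation C.k x) := fun x => rfl
  have hw0 : ∀ x : C.k, x ≠ 0 → w x ≠ 0 := by
    intro x hx h
    rw [hw] at h
    have : valuation C.k x = 0 := by
      have h' := congrArg e.symm h
      simpa using h'
    exact hx ((map_eq_zero _).mp this)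
  -- restrict to units and remove the zero
  let ord : C.kˣ →* Multiplicative ℤ :=
    (WithZero.unitsWithZeroEquiv.toMonoidHom).comp (Units.map w)
  obtain ⟨π₀, hπ₀⟩ := ValuativeRel.valuation_surjective
    (e.symm ((Multiplicative.ofAdd (1 : ℤ) : Multiplicative ℤ) : WithZero (Multiplicative ℤ)))
  have hπ₀0 : π₀ ≠ 0 := by
    intro h
    rw [h, map_zero] at hπ₀
    have := congrArg e hπ₀
    simp at this
  refine ⟨ord, Units.mk0 π₀ hπ₀0, ?_⟩
  apply WithZero.coe_inj.mp
  change ((WithZero.unitsWithZeroEquiv (Units.map w (Units.mk0 π₀ hπ₀0)) : Multiplicative ℤ) : WithZero (Multiplicative ℤ)) = _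
  rw [show ((WithZero.unitsWithZeroEquiv (Units.map w (Units.mk0 π₀ hπ₀0)) : Multiplicative ℤ) : WithZero (Multiplicative ℤ))
      = (Units.map w (Units.mk0 π₀ hπ₀0) : WithZero (Multiplicative ℤ)) from WithZero.coe_unzero _]
  simp only [Units.coe_map, Units.val_mk0, hw, hπ₀]
  simp

/-- The integer-valued valuation vanishes nowhere else: `ord x = ofAdd m` recovers the valuation; in
particular it is multiplicative on products and powers (used below only through `map_mul`,
`map_pow`). Recorded form: every nonzero `x ∈ k` has SOME integer order. (Trivial bookkeeping.)
[cite: MochizukiAbsTopIII2015, Definition 3.1 (i) p.66] -/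
theorem MLFClosure.exists_toAdd_ord (ord : C.kˣ →* Multiplicative ℤ) (x : C.kˣ) :
    ∃ m : ℤ, ord x = Multiplicative.ofAdd m :=
  ⟨Multiplicative.toAdd (ord x), by simp⟩


/-! ### The sign of an equivariant automorphism on the roots of unity -/

/-- **Sign lemma.**  A `Gal(k̄/k)`-equivariant multiplicative automorphism `β` of `k̄^× = (k̄)⁰`
acts on all roots of unity of `k̄` either trivially or by inversion.  (Equivariance is stated
pointwise: `β` commutes with every `σ ∈ Gal(k̄/k)` on underlying elements of `k̄`.)  This is the
elementary heart of the "fibers of cardinality two" clause of Prop. 3.3 (ii) (p. 74) / the "`{±1}`-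
… multiple" clause of Prop. 3.3 (i) (p. 73): the exponent by which `β` acts on `μ_n` is congruent mod `n`
to the `k`-order of `β(π)` for a uniformizer `π` of `k`, for every `n`.
[cite: MochizukiAbsTopIII2015, Proposition 3.3 (ii) p.74] -/
theorem MLFClosure.nonZeroDivisors_equivariant_rootsOfUnity_sign (β : (C.K)⁰ ≃* (C.K)⁰)
    (hβσ : ∀ (σ : C.K ≃ₐ[C.k] C.K) (x y : (C.K)⁰), (y : C.K) = σ x →
      ((β y : (C.K)⁰) : C.K) = σ ((β x : (C.K)⁰) : C.K)) :
    (∀ (ζ : (C.K)⁰) (n : ℕ), 0 < n → (ζ : C.K) ^ n = 1 → β ζ = ζ) ∨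
    (∀ (ζ : (C.K)⁰) (n : ℕ), 0 < n → (ζ : C.K) ^ n = 1 →
      ((β ζ : (C.K)⁰) : C.K) = (ζ : C.K)⁻¹) := by
  classical
  haveI : IsAlgClosed C.K := IsAlgClosure.isAlgClosed C.k
  haveI : CharZero C.K := C.charZero_K
  have hmem : ∀ {x : C.K}, x ≠ 0 → x ∈ (C.K)⁰ := fun hx => mem_nonZeroDivisors_of_ne_zero hx
  have hne : ∀ x : (C.K)⁰, (x : C.K) ≠ 0 := fun x => nonZeroDivisors.coe_ne_zero x
  have hβmul : ∀ x y : (C.K)⁰, ((β (x * y) : (C.K)⁰) : C.K) = (β x : C.K) * (β y : C.K) := by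
    intro x y; rw [map_mul]; rfl
  have hβpow : ∀ (x : (C.K)⁰) (m : ℕ), ((β (x ^ m) : (C.K)⁰) : C.K) = ((β x : (C.K)⁰) : C.K) ^ m := by
    intro x m; rw [map_pow, SubmonoidClass.coe_pow]
  have hβ1 : ((β 1 : (C.K)⁰) : C.K) = 1 := by rw [map_one]; rfl
  have hinj : ∀ ζ : (C.K)⁰, ((β ζ : (C.K)⁰) : C.K) = 1 → (ζ : C.K) = 1 := by
    intro ζ h
    have h1 : β ζ = 1 := Subtype.ext (by rw [h]; rfl)
    have h2 : ζ = 1 := β.injective (h1.trans (map_one β).symm)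
    rw [h2]; rfl
  -- (S1) `β` acts on `μ_n` by an exponent
  have S1 : ∀ n : ℕ, 0 < n → ∃ a : ℕ, ∀ ζ : (C.K)⁰, (ζ : C.K) ^ n = 1 →
      ((β ζ : (C.K)⁰) : C.K) = (ζ : C.K) ^ a := by
    intro n hn
    haveI : NeZero n := ⟨hn.ne'⟩
    obtain ⟨ζ₀, hζ₀⟩ := C.exists_isPrimitiveRoot n hn
    have hζ₀0 : ζ₀ ≠ 0 := hζ₀.ne_zero hn.ne'
    set z₀ : (C.K)⁰ := ⟨ζ₀, hmem hζ₀0⟩ with hz₀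
    have hz₀n : z₀ ^ n = 1 := Subtype.ext (by rw [SubmonoidClass.coe_pow]; simp [hz₀, hζ₀.pow_eq_one])
    have hβz₀ : ((β z₀ : (C.K)⁰) : C.K) ^ n = 1 := by rw [← hβpow, hz₀n, hβ1]
    obtain ⟨a, -, ha⟩ := hζ₀.eq_pow_of_pow_eq_one hβz₀
    refine ⟨a, fun ζ hζ => ?_⟩
    obtain ⟨i, -, hi⟩ := hζ₀.eq_pow_of_pow_eq_one hζ
    have hζeq : ζ = z₀ ^ i := Subtype.ext (by rw [SubmonoidClass.coe_pow]; simp [hz₀, hi])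
    have hcoe : ((z₀ ^ i : (C.K)⁰) : C.K) = ζ₀ ^ i := by rw [SubmonoidClass.coe_pow]
    rw [hζeq, hβpow, hcoe, ← ha, ← pow_mul, ← pow_mul, mul_comm]
  -- (S2) a uniformizer `π` of `k`, and `β(π) ∈ k` with `k`-order `A`
  obtain ⟨ord, π, hπ⟩ := C.exists_ord_uniformizer
  have hπ0 : (π : C.k) ≠ 0 := π.ne_zero
  set πK : C.K := algebraMap C.k C.K π with hπK
  have hπK0 : πK ≠ 0 := by
    rw [hπK]; exact (map_ne_zero_iff _ (algebraMap C.k C.K).injective).mpr hπ0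
  set pK : (C.K)⁰ := ⟨πK, hmem hπK0⟩ with hpK
  have hσπK : ∀ σ : C.K ≃ₐ[C.k] C.K, σ πK = πK := fun σ => by rw [hπK, AlgEquiv.commutes]
  have hfixβπ : ∀ σ : C.K ≃ₐ[C.k] C.K, σ ((β pK : (C.K)⁰) : C.K) = (β pK : C.K) := by
    intro σ
    exact (hβσ σ pK pK (by rw [hpK]; exact (hσπK σ).symm)).symm
  obtain ⟨b, hb⟩ := (InfiniteGalois.mem_range_algebraMap_iff_fixed ((β pK : (C.K)⁰) : C.K)).mpr hfixβπ
  have hb0 : b ≠ 0 := by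
    intro h; rw [h, map_zero] at hb; exact hne _ hb.symm
  set bu : C.kˣ := Units.mk0 b hb0 with hbu
  obtain ⟨A, hA⟩ := C.exists_toAdd_ord ord bu
  -- (S3) the congruence `a_n ≡ A (mod n)`
  have S3 : ∀ n : ℕ, 0 < n → ∀ a : ℕ, (∀ ζ : (C.K)⁰, (ζ : C.K) ^ n = 1 →
      ((β ζ : (C.K)⁰) : C.K) = (ζ : C.K) ^ a) → ∃ t : ℤ, (a : ℤ) = A + n * t := by
    intro n hn a ha
    obtain ⟨y, hy⟩ := IsAlgClosed.exists_pow_nat_eq πK hn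
    have hy0 : y ≠ 0 := by
      rintro rfl; rw [zero_pow hn.ne'] at hy; exact hπK0 hy.symm
    set yM : (C.K)⁰ := ⟨y, hmem hy0⟩ with hyM
    have hyMn : yM ^ n = pK := Subtype.ext (by rw [SubmonoidClass.coe_pow]; simp [hyM, hpK, hy])
    set Y : C.K := ((β yM : (C.K)⁰) : C.K) with hYdef
    have hY0 : Y ≠ 0 := hne _
    have hYn : Y ^ n = algebraMap C.k C.K b := by rw [hYdef, ← hβpow, hyMn, hb]
    -- the Galois action on `Y`
    have hσne : ∀ σ : C.K ≃ₐ[C.k] C.K, σ y ≠ 0 := fun σ =>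
      (map_ne_zero_iff σ σ.injective).mpr hy0
    have hσY : ∀ σ : C.K ≃ₐ[C.k] C.K, σ Y = (σ y / y) ^ a * Y := by
      intro σ
      have hξn : (σ y / y) ^ n = 1 := by
        rw [div_pow, ← map_pow, hy, hσπK σ, div_self hπK0]
      have hξ0 : σ y / y ≠ 0 := div_ne_zero (hσne σ) hy0
      set ξM : (C.K)⁰ := ⟨σ y / y, hmem hξ0⟩ with hξM
      have h1 := hβσ σ yM (ξM * yM) (by
        rw [Submonoid.coe_mul]; simp [hξM, hyM, div_mul_cancel₀ _ hy0])
      rw [hβmul, ha ξM hξn] at h1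
      exact h1.symm
    have hfixZ : ∀ σ : C.K ≃ₐ[C.k] C.K, σ (Y / y ^ a) = Y / y ^ a := by
      intro σ
      have hξ0 : σ y / y ≠ 0 := div_ne_zero (hσne σ) hy0
      calc σ (Y / y ^ a) = σ Y / (σ y) ^ a := by rw [map_div₀, map_pow]
        _ = ((σ y / y) ^ a * Y) / ((σ y / y) ^ a * y ^ a) := by
            rw [hσY σ, ← mul_pow, div_mul_cancel₀ _ hy0]
        _ = Y / y ^ a := mul_div_mul_left _ _ (pow_ne_zero _ hξ0)
    obtain ⟨c, hc⟩ := (InfiniteGalois.mem_range_algebraMap_iff_fixed (Y / y ^ a)).mpr hfixZ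
    have hc0 : c ≠ 0 := by
      intro h; rw [h, map_zero] at hc
      exact div_ne_zero hY0 (pow_ne_zero _ hy0) hc.symm
    -- `b = c ^ n * π ^ a` in `k`
    have hbcπ : b = c ^ n * (π : C.k) ^ a := by
      apply (algebraMap C.k C.K).injective
      rw [map_mul, map_pow, map_pow, hc, div_pow, ← pow_mul, mul_comm a n, pow_mul, hy, ← hπK,
        div_mul_cancel₀ _ (pow_ne_zero _ hπK0), hYn]
    set cu : C.kˣ := Units.mk0 c hc0 with hcu
    have hunits : bu = cu ^ n * π ^ a := Units.ext (by simp [hbu, hcu, hbcπ])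
    obtain ⟨m, hm⟩ := C.exists_toAdd_ord ord cu
    have hord := congrArg ord hunits
    rw [map_mul, map_pow, map_pow, hA, hπ, hm] at hord
    have hadd := congrArg Multiplicative.toAdd hord
    simp only [toAdd_ofAdd, toAdd_mul, toAdd_pow, nsmul_eq_mul, mul_one] at hadd
    exact ⟨-m, by linarith⟩
  -- (S4) `A = ±1`
  have hA1 : A = 1 ∨ A = -1 := by
    have htri : A = 1 ∨ A = -1 ∨ (A = 0 ∨ 2 ≤ A.natAbs) := by omega
    rcases htri with h | h | hrest
    · exact Or.inl h
    · exact Or.inr h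
    exfalso
    rcases hrest with hA0 | hA2
    · obtain ⟨a, ha⟩ := S1 2 two_pos
      obtain ⟨t, ht⟩ := S3 2 two_pos a ha
      have hdvd : (2 : ℤ) ∣ (a : ℤ) := ⟨t, by rw [ht, hA0]; ring⟩
      have heven : Even a := even_iff_two_dvd.mpr (by exact_mod_cast hdvd)
      set m1 : (C.K)⁰ := ⟨-1, hmem (neg_ne_zero.mpr one_ne_zero)⟩ with hm1
      have h1 : ((β m1 : (C.K)⁰) : C.K) = 1 := by
        rw [ha m1 (by simp [hm1]), hm1]
        exact heven.neg_one_pow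
      have h2 := hinj m1 h1
      simp only [hm1] at h2
      norm_num at h2
    · set m := A.natAbs with hmdef
      have hm2 : 2 ≤ m := hA2
      have hmpos : 0 < m := by omega
      obtain ⟨ζ₁, hζ₁⟩ := C.exists_isPrimitiveRoot m hmpos
      obtain ⟨a, ha⟩ := S1 m hmpos
      obtain ⟨t, ht⟩ := S3 m hmpos a ha
      have hζ₁0 : ζ₁ ≠ 0 := hζ₁.ne_zero hmpos.ne'
      set zM : (C.K)⁰ := ⟨ζ₁, hmem hζ₁0⟩ with hzM
      have hmA : (m : ℤ) ∣ A := by rw [hmdef]; exact Int.natAbs_dvd.mpr dvd_rfl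
      have hma' : (m : ℤ) ∣ (a : ℤ) := by
        rw [ht]; exact dvd_add hmA (dvd_mul_right _ _)
      have hma : m ∣ a := by exact_mod_cast hma'
      have h1 : ((β zM : (C.K)⁰) : C.K) = 1 := by
        rw [ha zM (by simp [hzM, hζ₁.pow_eq_one]), hzM]
        exact (hζ₁.pow_eq_one_iff_dvd a).mpr hma
      have h2 := hinj zM h1
      simp only [hzM] at h2
      exact hζ₁.ne_one hm2 h2
  -- (S5) conclusion
  rcases hA1 with hA1 | hA1
  · left
    intro ζ n hn hζ
    obtain ⟨a, ha⟩ := S1 n hn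
    obtain ⟨t, ht⟩ := S3 n hn a ha
    apply Subtype.ext
    rw [ha ζ hζ, ← zpow_natCast, ht, hA1, zpow_add₀ (hne ζ), zpow_one, zpow_mul, zpow_natCast, hζ,
      one_zpow, mul_one]
  · right
    intro ζ n hn hζ
    obtain ⟨a, ha⟩ := S1 n hn
    obtain ⟨t, ht⟩ := S3 n hn a ha
    rw [ha ζ hζ, ← zpow_natCast, ht, hA1, zpow_add₀ (hne ζ), zpow_neg_one, zpow_mul, zpow_natCast,
      hζ, one_zpow, mul_one]

/-! ### The dichotomy: identity or inversion -/

/-- **[AbsTopIII] Prop 3.3 (ii), `{±1}`-torsor half at the model — PROVED.**  A `Gal(k̄/k)`-equivariant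
multiplicative automorphism of the `TLG` model object `k̄^× = (k̄)⁰` is the identity or the inversion
`x ↦ x⁻¹` — the mathematical content of print's "is only determined up to a `{±1}`- … multiple if
`T = TLG`" (Prop. 3.3 (i), p. 73) and "surjective, with fibers of cardinality two" (Prop. 3.3 (ii), p. 74)
at the model `(k, k̄)`.  Proof: by the sign lemma `β` (resp. `β ∘ inv`) fixes every root of unity, so it is
the identity by the Kummer-class rigidity `MLFClosure.submonoid_equivariant_eq_self`.  Same statement as
abc-iut-L6-t21's earlier `MLFClosure.nonZeroDivisors_mulEquiv_eq_self_or_eq_inv` (theorem of record).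
[cite: MochizukiAbsTopIII2015, Proposition 3.3 (ii) p.74] -/
theorem MLFClosure.nonZeroDivisors_equivariant_eq_id_or_inv (β : (C.K)⁰ ≃* (C.K)⁰)
    (hβσ : ∀ (σ : C.K ≃ₐ[C.k] C.K) (x y : (C.K)⁰), (y : C.K) = σ x →
      ((β y : (C.K)⁰) : C.K) = σ ((β x : (C.K)⁰) : C.K)) :
    (∀ x : (C.K)⁰, β x = x) ∨ (∀ x : (C.K)⁰, ((β x : (C.K)⁰) : C.K) = (x : C.K)⁻¹) := by
  classical
  haveI : IsAlgClosed C.K := IsAlgClosure.isAlgClosed C.k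
  have hmem : ∀ {x : C.K}, x ≠ 0 → x ∈ (C.K)⁰ := fun hx => mem_nonZeroDivisors_of_ne_zero hx
  have hne : ∀ x : (C.K)⁰, (x : C.K) ≠ 0 := fun x => nonZeroDivisors.coe_ne_zero x
  have hM : ∀ (σ : C.K ≃ₐ[C.k] C.K) (x : C.K), x ∈ (C.K)⁰ → σ x ∈ (C.K)⁰ := fun σ x hx =>
    hmem ((map_ne_zero_iff σ σ.injective).mpr (nonZeroDivisors.ne_zero hx))
  have hroot : ∀ x ∈ (C.K)⁰, ∀ n : ℕ, 0 < n → ∃ y ∈ (C.K)⁰, y ^ n = x := by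
    intro x hx n hn
    obtain ⟨y, hy⟩ := IsAlgClosed.exists_pow_nat_eq x hn
    have hy0 : y ≠ 0 := by
      rintro rfl
      rw [zero_pow hn.ne'] at hy
      exact nonZeroDivisors.ne_zero hx hy.symm
    exact ⟨y, hmem hy0, hy⟩
  have hμ : ∀ (ζ : C.K) (n : ℕ), 0 < n → ζ ^ n = 1 → ζ ∈ (C.K)⁰ := by
    intro ζ n hn hζ
    refine hmem fun h => ?_
    rw [h, zero_pow hn.ne'] at hζ
    exact zero_ne_one hζ
  have h0 : (0 : C.K) ∉ (C.K)⁰ := zero_notMem_nonZeroDivisors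
  rcases C.nonZeroDivisors_equivariant_rootsOfUnity_sign β hβσ with hfix | hneg
  · left
    refine C.submonoid_equivariant_eq_self (nonZeroDivisors C.K) hM hroot hμ h0 β.toMonoidHom ?_ ?_
    · intro σ x
      exact hβσ σ x ⟨σ x, hM σ x x.2⟩ rfl
    · intro x n hn hx
      exact hfix x n hn hx
  · right
    -- the inversion of `(k̄)⁰` and `γ := β ∘ inv`
    let inv : (C.K)⁰ →* (C.K)⁰ :=
      { toFun := fun x => ⟨(x : C.K)⁻¹, hmem (inv_ne_zero (hne x))⟩
        map_one' := Subtype.ext (by simp)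
        map_mul' := fun x y => Subtype.ext (by
          change ((x * y : (C.K)⁰) : C.K)⁻¹ = (x : C.K)⁻¹ * (y : C.K)⁻¹
          rw [Submonoid.coe_mul, mul_inv]) }
    have hinv : ∀ x : (C.K)⁰, ((inv x : (C.K)⁰) : C.K) = (x : C.K)⁻¹ := fun x => rfl
    have hii : ∀ x : (C.K)⁰, inv (inv x) = x := fun x => Subtype.ext (by rw [hinv, hinv, inv_inv])
    let γ : (C.K)⁰ →* (C.K)⁰ := β.toMonoidHom.comp inv
    have hγ : ∀ x, γ x = β (inv x) := fun x => rfl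
    have hγσ : ∀ (σ : C.K ≃ₐ[C.k] C.K) (x : (C.K)⁰),
        ((γ ⟨σ x, hM σ x x.2⟩ : (C.K)⁰) : C.K) = σ ((γ x : (C.K)⁰) : C.K) := by
      intro σ x
      rw [hγ, hγ]
      exact hβσ σ (inv x) (inv ⟨σ x, hM σ x x.2⟩) (by rw [hinv, hinv, map_inv₀])
    have hγμ : ∀ (x : (C.K)⁰) (n : ℕ), 0 < n → (x : C.K) ^ n = 1 → γ x = x := by
      intro x n hn hx
      have hx' : ((inv x : (C.K)⁰) : C.K) ^ n = 1 := by rw [hinv, inv_pow, hx, inv_one]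
      rw [hγ]
      exact Subtype.ext (by rw [hneg (inv x) n hn hx', hinv, inv_inv])
    have hγid := C.submonoid_equivariant_eq_self (nonZeroDivisors C.K) hM hroot hμ h0 γ hγσ hγμ
    intro x
    have h := hγid (inv x)
    rw [hγ, hii] at h
    rw [h, hinv]

end Literature.AnabelianGeometry.AbsoluteAnabelian

end
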